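import Literature.MathematicalPhysics.QuantumFieldTheory.Balaban1983to89.B9Eq319BlockTentLift
import Literature.MathematicalPhysics.QuantumFieldTheory.Balaban1983to89.B9Eq315QFlatNorm

/-!
# `Balaban1983to89.B9Eq3126BondTentLift` — T. Bałaban, *Propagators for lattice gauge theories in a background field*, Commun. Math. Phys. **99** (1985)
# 389–434 [Balaban1985BackgroundPropagators] (3.126) p. 420 `HB = GQ*(QGQ*)⁻¹B`, Thm 3.11 p. 416, (3.15) p. 393, (3.4)∕(3.8) pp. 391–392, with
# [Balaban1985Averaging] (125) p. 36: **BLOCK-PRODUCT LIFTS `u(x,κ) = f₁(off_κ x)·Π_{ν≠κ} f₀(off_ν x)·ψ(blk x, κ)` OF A COARSE BOND FIELD AT THE FLAT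
# ONE-STEP VECTOR AVERAGING — `Q(1)u = A·ψ + B·ψ(·+e_κ)` with the two sweep counts, the pairing `(A − |B|)‖ψ‖² ≤ re⟪Q(1)u, ψ⟫`, the size
# `‖Q(1)u‖² ≤ 2(A² + B²)‖ψ‖²`** — the BOND analogue (averaging half) of ne9-leaf-01's site kit
# `B9Eq319BlockTentLift`, i.e. the test-family kit of the pub-balaban NE9 chain's variational `H₁`-currency (`B9Eq3126GreenLettersVariational`)

statement-level skeleton of published theorems with citation tags; proofs where landed; nothing here is a claim about the Yang–Mills mass gap

CITATION HEADER (lean-in-tree rule).  Audit cell `pub-balaban`, sub-cell `t4`, BINDER row NE9; filed by NE9 formalisation-swarm LEAF PROVER 02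
(`b2b-balaban-t4-ne9-formalise-leaf-02`, gen 65).  Sources READ in the held text layers: [Balaban1985BackgroundPropagators]
(`paper:balaban1985-cmp99-background-propagators`, journal page = PDF page + 388) pp. 391–393 (3.4), (3.8), (3.11), (3.15), p. 416 Thm 3.11, p. 420 (3.126);
[Balaban1985Averaging] (`paper:balaban1985-cmp98-averaging`, journal page = PDF page + 16) p. 17 (2), p. 36 (125) — via the tree's `B7Prop3Flat.Q0form`,
`B7Prop3Flat.frame_cancellation` and `B9Eq315QFlatNorm.QtorusLin_one_apply` (ne9-leaf-03 g58), consumed BY NAME.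

THE PRINT (verbatim).  [B7] (125) p. 36: *«(Q₀A)_c = Σ_{x∈B(c₋)} L^{−(d+1)} A([x, x′])»* — at `V₀ = 1` the one-step vector averaging at the coarse bond
`c = ⟨y, y + e_κ⟩` is the mean of `A` over the `L^{d+1}` fine bonds of the straight segments `[x, x + Le_κ]`, `x ∈ B(y)` (the tree-contour pieces cancel
against the frames, `B7Prop3Flat.frame_cancellation`).  [B9] (3.4) p. 391 the covariant curl, (3.8) p. 392 `D*`, (3.11) p. 392 the `η^d`-weighted
pairings; p. 416, Thm 3.11: *«the operators Δ′_a, G′, (Q′G′²Q′*)⁻¹, Δ_a, G are positive definite»*; p. 420, (3.126): *«HB = GQ*(QGQ*)⁻¹B»*.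

WHY THIS FILE (cell context).  The `M`-free letters of `B9Eq3126GreenLettersVariational` (this lineage, gen 65) bound `(QG₁Q†)⁻¹` and `H₁ = G₁Q†(QG₁Q†)⁻¹`
by the coercivity constant of `Δ_a` and ONE test family `u_ψ` with `β‖ψ‖² ≤ re⟪Qu_ψ, ψ⟫` and a FORM bound `re⟪u_ψ, Δ_a u_ψ⟫ ≤ M_u‖ψ‖²`.  For print's
one-step vector averaging `Q(1)` of BOND fields the segments of `⟨y, y+e_κ⟩` sweep the own block `B(y)` with the counts `k+1` (depth `k` along `κ`)
and the NEXT block `B(y+e_κ)` with the counts `L−1−k`, so a lifted test field is read by TWO coarse bonds; this file evaluates that reading exactly for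
block-product lifts (§2, §4), turns it into the pairing and size bounds (§3), while the two Dirichlet forms of (3.10)∕(3.26) at the flat background —
`‖D*u‖²` and `‖curl u‖²` — from a per-step bound of the lift are the companion `B9Eq3126BondLiftEnergy`.  The arithmetic of the skewed profile (margin
`Σ(2k+2−L)q(k) ∝ L⁵`) is `B9Eq3126BondTentProfile`; the assembly (`κ_K`, `C_H` at `U = 1`, level-free on the diagonal) is the sequel.

WHAT IS PROVED (sorry-free; 0 `def`; [folklore] finite-lattice bookkeeping; nothing of [B9]∕[B7] asserted).
* §1 `boxVec_update`, `cornerSite_add_boxVec_add_smul_of_lt` ∕ `_of_ge` (a swept site `L·y + r + ie_κ` is `L·y + r[κ ↦ r_κ+i]` resp. `L·(y+e_κ) + r[κ ↦ t]`),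
  `offset_blockCoord_sweep_of_lt` ∕ `_of_ge` (its offsets and block), `prod_update_eq`, **`sum_prod_erase_mul_eq`** (`Σ_r (Π_{ν≠κ}F_ν(r_ν))g(r_κ) =
  (Π_{ν≠κ}ΣF_ν)·Σg`).
* §2 **`sum_sweep_prodLift`** — `Σ_rΣ_{i<L} u(L·y+r+ie_κ, κ) = [Π_{ν≠κ}ΣF^κ_ν]·[Σ_kΣ_{i<L−k}F^κ_κ(k+i)]·ψ(y,κ) + [Π_{ν≠κ}ΣF^κ_ν]·[Σ_kΣ_{t<k}F^κ_κ(t)]·ψ(y+e_κ,κ)`.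
* §3 TWO-BLOCK FORMS `v(y,κ) = A·ψ(y,κ) + B·ψ(y+e_κ,κ)`: `sum_shift_bond_eq`, **`re_inner_ge_of_twoBlock`** (`(A − |B|)‖ψ‖² ≤ re⟪v, ψ⟫`),
  **`norm_sq_le_of_twoBlock`** (`‖v‖² ≤ 2(A²+B²)‖ψ‖²`).
* §4 `twoProfile_eq_prod`, `prod_erase_sum_twoProfile`, **`QtorusW_one_twoProfileLift_apply`** — `Q(1)` of the two-profile lift IS a two-block form with
  `A = L^{−(d+1)}(Σf₀)^{d−1}Σ_kΣ_{i<L−k}f₁(k+i)`, `B = L^{−(d+1)}(Σf₀)^{d−1}Σ_kΣ_{t<k}f₁(t)`, the same at every coarse bond.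
HONEST SCOPE.  Elementary; flat background only; crude constants; NOT NE9, NOT the route (cell pub-balaban: NE9 NOT PRINTED ∕ NOT PROVED; «NE9 ⇐ the named
binders»; row WALLED ON A MODEL (O-NE9-1; #5 UNRULED); spine PROVED 0∕9; rung (B)+1 on a finite T⁴ — NOT infinite volume, NOT mass gap, NOT Clay).  HONEST DEPENDENCY
(cell line): continuum YM on T⁴ ⇐ BetaPertH ∧ nine spine estimates (0/9 proved); BetaPertH ⇐ (D1) ∧ (D4) ∧ CAP+tail; G-an2-4 gates asym, D1 and NE2/3/4.  NEW file
importing `B9Eq319BlockTentLift` (ne9-leaf-01 g78) and `B9Eq315QFlatNorm` (ne9-leaf-03 g58); nothing modified.  Net new unproved facts: 0.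
-/

noncomputable section

open scoped InnerProductSpace ComplexConjugate BigOperators

namespace Literature.MathematicalPhysics.QuantumFieldTheory.Balaban1983to89.B9Eq3126BondTentLift

open B4Sect5Torus (TSite)
open B9SectCLatticeCarrier (Bond shift unshift bpos btgt)
open B9Eq311L2Pairing (WL2)
open B9Eq319QprimeTorus (fineP offset offset_lt blockCoord mem_blockOf_iff)
open B9Eq315QTorus (perSite perCfg cornerSite QtorusLin QtorusW QtorusW_apply)
open B7Prop1Explicit (U1 Wcx boxVec e e_apply)
open B11Eq103H1Complex (SiteL2K BondL2K covDivL2K equiv_covDivL2K)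
open B9Eq33CovDerivVector (covDiv covDiv_apply shiftEquiv)
open B9Eq34CovCurlVector (covCurl covCurl_apply_coord)
open B9Eq310HessianOperator (adTransportW PlaqL2K covCurlL2K equiv_covCurlL2K)
open B5Eq172HodgePositivity (adTransportW_one)
open B5Eq155FlatAveragingCommute (sum_blockOf_eq_sum_boxVec offset_perSite_cornerSite_add_boxVec perSite_cornerSite_add_boxVec_mem
  perSite_cornerSite_add_boxVec_add)
open B5Eq172FlatCoercivity (card_blockOf)
open B9Eq319QprimeLipschitz (sum_blockOf_sum)
open B9Eq315QFlatNorm (QtorusLin_one_apply)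

/-! ## §1 The swept sites `L·y + r + i·e_κ` in block coordinates -/

section Geometry

variable {d : ℕ} (L : ℕ) [NeZero L] (m : Fin d → ℕ) [∀ i, NeZero (fineP L m i)]

omit [NeZero L] in
/-- `boxVec` of an updated offset: `boxVec (r[κ ↦ v]) = boxVec r + (v − r_κ)·e_κ`. [folklore] [cite: Balaban1985Averaging, (2) p.17] -/
theorem boxVec_update (r : Fin d → Fin L) (κ : Fin d) (v : Fin L) :
    boxVec L (Function.update r κ v) = boxVec L r + (((v : ℕ) : ℤ) - ((r κ : ℕ) : ℤ)) • e κ := by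
  funext i
  simp only [boxVec, Pi.add_apply, Pi.smul_apply, e_apply, smul_eq_mul]
  by_cases h : i = κ
  · subst h; rw [Function.update_self, if_pos rfl]; ring
  · rw [Function.update_of_ne h, if_neg h]; ring

omit [NeZero L] [∀ i, NeZero (fineP L m i)] in
/-- **a swept site inside the own block**: for `i < L − r_κ`, `L·y + r + i·e_κ = L·y + r[κ ↦ r_κ + i]`. [folklore] [cite: Balaban1985Averaging, (2) p.17, (125) p.36] -/
theorem cornerSite_add_boxVec_add_smul_of_lt (y : TSite d m) (r : Fin d → Fin L) (κ : Fin d) {i : ℕ} (hi : (r κ : ℕ) + i < L) :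
    cornerSite L y + boxVec L r + (i : ℤ) • e κ = cornerSite L y + boxVec L (Function.update r κ ⟨(r κ : ℕ) + i, hi⟩) := by
  rw [boxVec_update, add_assoc]
  congr 2
  push_cast
  ring

omit [NeZero L] [∀ i, NeZero (fineP L m i)] in
/-- **a swept site in the next block**: for `t < r_κ`, `L·y + r + (L − r_κ + t)·e_κ = L·y + r[κ ↦ t] + L·e_κ`. [folklore]
[cite: Balaban1985Averaging, (2) p.17, (125) p.36] -/
theorem cornerSite_add_boxVec_add_smul_of_ge (y : TSite d m) (r : Fin d → Fin L) (κ : Fin d) {t : ℕ} (ht : t < (r κ : ℕ)) :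
    cornerSite L y + boxVec L r + (((L - (r κ : ℕ) + t : ℕ) : ℤ)) • e κ =
      cornerSite L y + boxVec L (Function.update r κ ⟨t, ht.trans (r κ).isLt⟩) + (L : ℤ) • e κ := by
  have hle : (r κ : ℕ) ≤ L := (r κ).isLt.le
  have hc : (((L - (r κ : ℕ) + t : ℕ) : ℤ)) = (((⟨t, ht.trans (r κ).isLt⟩ : Fin L) : ℕ) : ℤ) - ((r κ : ℕ) : ℤ) + (L : ℤ) := by
    push_cast [Nat.cast_sub hle]
    ring
  rw [boxVec_update, hc, add_smul]
  abel

/-- offsets and block of a swept site inside the own block. [folklore] [cite: Balaban1985Averaging, (2) p.17, (125) p.36] -/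
theorem offset_blockCoord_sweep_of_lt (y : TSite d m) (r : Fin d → Fin L) (κ : Fin d) {i : ℕ} (hi : (r κ : ℕ) + i < L) :
    (∀ ν, offset L m (perSite (fineP L m) (cornerSite L y + boxVec L r + (i : ℤ) • e κ)) ν =
        ((Function.update r κ (⟨(r κ : ℕ) + i, hi⟩ : Fin L) ν : ℕ))) ∧
      blockCoord L m (perSite (fineP L m) (cornerSite L y + boxVec L r + (i : ℤ) • e κ)) = y := by
  rw [cornerSite_add_boxVec_add_smul_of_lt L m y r κ hi]
  exact ⟨fun ν => offset_perSite_cornerSite_add_boxVec L m y _ ν, (mem_blockOf_iff L m y _).1 (perSite_cornerSite_add_boxVec_mem L m y _)⟩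

/-- offsets and block of a swept site in the next block. [folklore] [cite: Balaban1985Averaging, (2) p.17, (125) p.36] -/
theorem offset_blockCoord_sweep_of_ge (y : TSite d m) (r : Fin d → Fin L) (κ : Fin d) {t : ℕ} (ht : t < (r κ : ℕ)) :
    (∀ ν, offset L m (perSite (fineP L m) (cornerSite L y + boxVec L r + (((L - (r κ : ℕ) + t : ℕ) : ℤ)) • e κ)) ν =
        ((Function.update r κ (⟨t, ht.trans (r κ).isLt⟩ : Fin L) ν : ℕ))) ∧
      blockCoord L m (perSite (fineP L m) (cornerSite L y + boxVec L r + (((L - (r κ : ℕ) + t : ℕ) : ℤ)) • e κ)) = shift κ y := by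
  rw [cornerSite_add_boxVec_add_smul_of_ge L m y r κ ht, perSite_cornerSite_add_boxVec_add]
  exact ⟨fun ν => offset_perSite_cornerSite_add_boxVec L m (shift κ y) _ ν,
    (mem_blockOf_iff L m (shift κ y) _).1 (perSite_cornerSite_add_boxVec_mem L m (shift κ y) _)⟩

omit [NeZero L] [∀ i, NeZero (fineP L m i)] in
/-- a product of one-coordinate profiles at an updated offset factorises: `Π_ν F_ν(r[κ ↦ v]_ν) = F_κ(v)·Π_{ν≠κ} F_ν(r_ν)`. [folklore]
[cite: Balaban1984PropagatorsII, (2.74)–(2.77) p.236] -/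
theorem prod_update_eq (F : Fin d → ℕ → ℝ) (r : Fin d → Fin L) (κ : Fin d) (v : Fin L) :
    ∏ ν, F ν ((Function.update r κ v ν : ℕ)) = F κ (v : ℕ) * ∏ ν ∈ Finset.univ.erase κ, F ν ((r ν : ℕ)) := by
  rw [← Finset.mul_prod_erase Finset.univ _ (Finset.mem_univ κ), Function.update_self]
  congr 1
  exact Finset.prod_congr rfl fun ν hν => by rw [Function.update_of_ne (Finset.ne_of_mem_erase hν)]

omit [NeZero L] [∀ i, NeZero (fineP L m i)] in
/-- **factorisation of a block sum of a product with one distinguished coordinate**: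
`Σ_{r∈[0,L)^d} (Π_{ν≠κ} F_ν(r_ν))·g(r_κ) = (Π_{ν≠κ} Σ_{k<L} F_ν(k))·Σ_{k<L} g(k)`. [folklore] [cite: Balaban1984PropagatorsII, (2.74)–(2.77) p.236] -/
theorem sum_prod_erase_mul_eq (F : Fin d → ℕ → ℝ) (g : ℕ → ℝ) (κ : Fin d) :
    ∑ r : Fin d → Fin L, (∏ ν ∈ Finset.univ.erase κ, F ν ((r ν : ℕ))) * g (r κ : ℕ) =
      (∏ ν ∈ Finset.univ.erase κ, ∑ k ∈ Finset.range L, F ν k) * ∑ k ∈ Finset.range L, g k := by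
  classical
  set G : Fin d → ℕ → ℝ := Function.update F κ g with hG
  have h1 : ∀ r : Fin d → Fin L, (∏ ν ∈ Finset.univ.erase κ, F ν ((r ν : ℕ))) * g (r κ : ℕ) = ∏ ν, G ν ((r ν : ℕ)) := by
    intro r
    rw [← Finset.mul_prod_erase Finset.univ _ (Finset.mem_univ κ), hG, Function.update_self, mul_comm]
    congr 1
    exact Finset.prod_congr rfl fun ν hν => by rw [Function.update_of_ne (Finset.ne_of_mem_erase hν)]
  have h2 : (∏ ν ∈ Finset.univ.erase κ, ∑ k ∈ Finset.range L, F ν k) * ∑ k ∈ Finset.range L, g k = ∏ ν, ∑ k ∈ Finset.range L, G ν k := by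
    rw [← Finset.mul_prod_erase Finset.univ _ (Finset.mem_univ κ), hG, Function.update_self, mul_comm]
    congr 1
    exact Finset.prod_congr rfl fun ν hν => by rw [Function.update_of_ne (Finset.ne_of_mem_erase hν)]
  rw [Finset.sum_congr rfl fun r _ => h1 r, h2]
  have h3 : ∀ ν, ∑ k ∈ Finset.range L, G ν k = ∑ k : Fin L, G ν (k : ℕ) := fun ν => (Fin.sum_univ_eq_sum_range (G ν) L).symm
  simp only [h3]
  rw [Fintype.prod_sum]

end Geometry

/-! ## §2 `Q(1)` of a block-product lift of a coarse BOND field: own block and next block -/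

section Sweep

variable {d : ℕ} (L : ℕ) [NeZero L] (m : Fin d → ℕ) [∀ i, NeZero (fineP L m i)]
  {𝔸 : Type*} [NormedRing 𝔸] [NormOneClass 𝔸] [NormedAlgebra ℂ 𝔸] [CompleteSpace 𝔸] (hL : 1 ≤ L)
  {α' : ℝ} (hα1' : α' ≤ 1 / 64)
  (hU1' : ∀ (x : B7Prop1Explicit.Site d) (κ : Fin d), perCfg (fineP L m) (fun _ : Bond d (fineP L m) => (1 : 𝔸ˣ)) x κ ∈ U1 𝔸)
  (hreg' : ∀ (y : TSite d m) (κ : Fin d) (r : Fin d → Fin L),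
    ‖((Wcx L (perCfg (fineP L m) (fun _ : Bond d (fineP L m) => (1 : 𝔸ˣ))) (cornerSite L y) κ (boxVec L r) : 𝔸ˣ) : 𝔸) - 1‖ ≤ α')
  {W : Type*} [NormedAddCommGroup W] [InnerProductSpace ℂ W] (φ : W ≃ₗ[ℂ] 𝔸) (c₀ : ℝ) (c₁ : ℝ)

/-- **THE SWEEP OF ONE COARSE BOND OVER A BLOCK-PRODUCT LIFT**: for `u(x, κ) = (Π_ν F^κ_ν(off_ν x))·ψ(blk x, κ)`,
`Σ_{r}Σ_{i<L} u(L·y + r + ie_κ, κ) = [Π_{ν≠κ}ΣF^κ_ν]·[Σ_{k}Σ_{i<L−k}F^κ_κ(k+i)]·ψ(y,κ) + [Π_{ν≠κ}ΣF^κ_ν]·[Σ_kΣ_{t<k}F^κ_κ(t)]·ψ(y+e_κ,κ)` — the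
`L^{d+1}` segments of `⟨y, y+e_κ⟩` ([B7] (125)) read the own block with the counts `k+1` and the next block with the counts `L−1−k`. [folklore]
[cite: Balaban1985Averaging, (125) p.36; Balaban1985BackgroundPropagators, (3.15) p.393] -/
theorem sum_sweep_prodLift (F : Fin d → Fin d → ℕ → ℝ) (ψt : Bond d m → W) (y : TSite d m) (κ : Fin d) :
    ∑ r : Fin d → Fin L, ∑ i ∈ Finset.range L,
        ((∏ ν, F κ ν (offset L m (perSite (fineP L m) (cornerSite L y + boxVec L r + (i : ℤ) • e κ)) ν) : ℝ) : ℂ) •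
          ψt (blockCoord L m (perSite (fineP L m) (cornerSite L y + boxVec L r + (i : ℤ) • e κ)), κ) =
      ((((∏ ν ∈ Finset.univ.erase κ, ∑ k ∈ Finset.range L, F κ ν k) *
          ∑ k ∈ Finset.range L, ∑ i ∈ Finset.range (L - k), F κ κ (k + i) : ℝ) : ℂ)) • ψt (y, κ) +
      ((((∏ ν ∈ Finset.univ.erase κ, ∑ k ∈ Finset.range L, F κ ν k) *
          ∑ k ∈ Finset.range L, ∑ t ∈ Finset.range k, F κ κ t : ℝ) : ℂ)) • ψt (shift κ y, κ) := by
  -- each segment: own block for `i < L − r_κ`, next block for the remaining `r_κ` steps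
  have hr : ∀ r : Fin d → Fin L, ∑ i ∈ Finset.range L,
      ((∏ ν, F κ ν (offset L m (perSite (fineP L m) (cornerSite L y + boxVec L r + (i : ℤ) • e κ)) ν) : ℝ) : ℂ) •
        ψt (blockCoord L m (perSite (fineP L m) (cornerSite L y + boxVec L r + (i : ℤ) • e κ)), κ) =
      (((∏ ν ∈ Finset.univ.erase κ, F κ ν ((r ν : ℕ))) * ∑ i ∈ Finset.range (L - (r κ : ℕ)), F κ κ ((r κ : ℕ) + i) : ℝ) : ℂ) • ψt (y, κ) +
      (((∏ ν ∈ Finset.univ.erase κ, F κ ν ((r ν : ℕ))) * ∑ t ∈ Finset.range (r κ : ℕ), F κ κ t : ℝ) : ℂ) • ψt (shift κ y, κ) := by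
    intro r
    have hle : (r κ : ℕ) ≤ L := (r κ).isLt.le
    rw [← Finset.sum_range_add_sum_Ico _ (Nat.sub_le L (r κ : ℕ)), Finset.sum_Ico_eq_sum_range, Nat.sub_sub_self hle]
    congr 1
    · rw [Finset.mul_sum, Complex.ofReal_sum, Finset.sum_smul]
      refine Finset.sum_congr rfl fun i hi => ?_
      have hi' : (r κ : ℕ) + i < L := by have := Finset.mem_range.1 hi; omega
      obtain ⟨hoff, hblk⟩ := offset_blockCoord_sweep_of_lt L m y r κ hi'
      rw [hblk, Finset.prod_congr rfl fun ν _ => by rw [hoff ν], prod_update_eq, mul_comm]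
    · rw [Finset.mul_sum, Complex.ofReal_sum, Finset.sum_smul]
      refine Finset.sum_congr rfl fun t ht => ?_
      have ht' : t < (r κ : ℕ) := Finset.mem_range.1 ht
      have hcast : ((L - (r κ : ℕ) + t : ℕ) : ℤ) = (((L - (r κ : ℕ) + t : ℕ) : ℕ) : ℤ) := rfl
      obtain ⟨hoff, hblk⟩ := offset_blockCoord_sweep_of_ge L m y r κ ht'
      rw [hblk, Finset.prod_congr rfl fun ν _ => by rw [hoff ν], prod_update_eq, mul_comm]
  rw [Finset.sum_congr rfl fun r _ => hr r, Finset.sum_add_distrib, ← Finset.sum_smul, ← Finset.sum_smul, ← Complex.ofReal_sum,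
    ← Complex.ofReal_sum, sum_prod_erase_mul_eq L (F κ) (fun k => ∑ i ∈ Finset.range (L - k), F κ κ (k + i)) κ,
    sum_prod_erase_mul_eq L (F κ) (fun k => ∑ t ∈ Finset.range k, F κ κ t) κ]

end Sweep

/-! ## §3 Two-block forms: `v(c) = A·ψ(c) + B·ψ(c + e_κ)` — the pairing with `ψ` and the size -/

section TwoBlock

variable {d : ℕ} (m : Fin d → ℕ) {W : Type*} [NormedAddCommGroup W] [InnerProductSpace ℂ W] (c₁ : ℝ) [Fact (0 < c₁)]

/-- the forward shift of a coarse bond along its own direction, `(y, κ) ↦ (y + e_κ, κ)`, is a permutation of the bonds. [folklore]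
[cite: Balaban1985Averaging, (2) p.17] -/
theorem sum_shift_bond_eq (g : Bond d m → ℝ) : ∑ c : Bond d m, g (shift c.2 c.1, c.2) = ∑ c : Bond d m, g c := by
  refine Fintype.sum_equiv ⟨fun c => (shift c.2 c.1, c.2), fun c => (unshift c.2 c.1, c.2), fun c => ?_, fun c => ?_⟩ _ _ fun c => rfl
  · simp only [B9SectCLatticeCarrier.unshift_shift]
  · simp only [B9SectCLatticeCarrier.shift_unshift]

/-- **THE PAIRING OF A TWO-BLOCK FORM WITH `ψ`**: if `v(y,κ) = A·ψ(y,κ) + B·ψ(y+e_κ,κ)` (`A, B` real) then `(A − |B|)·‖ψ‖² ≤ re⟪v, ψ⟫` in the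
weighted `L²(c₁)` — Cauchy–Schwarz on the cross term and the shift-invariance of `Σ_c‖ψ(c)‖²`. [folklore]
[cite: Balaban1985BackgroundPropagators, (3.15)–(3.16) p.393; Balaban1985Averaging, (125) p.36] -/
theorem re_inner_ge_of_twoBlock (v ψ : BondL2K ℂ d m c₁ W) {A B : ℝ}
    (hv : ∀ c : Bond d m, WL2.equiv ℂ (fun _ : Bond d m => c₁) W v c =
      ((A : ℝ) : ℂ) • WL2.equiv ℂ (fun _ : Bond d m => c₁) W ψ c + ((B : ℝ) : ℂ) • WL2.equiv ℂ (fun _ : Bond d m => c₁) W ψ (shift c.2 c.1, c.2)) :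
    (A - |B|) * ‖ψ‖ ^ 2 ≤ RCLike.re ⟪v, ψ⟫_ℂ := by
  have hc₁ : 0 < c₁ := Fact.out
  set ψt := WL2.equiv ℂ (fun _ : Bond d m => c₁) W ψ with hψt
  -- pointwise: `re(c₁·⟪v c, ψ c⟫) ≥ c₁(A‖ψ c‖² − |B|(‖ψ(sc)‖² + ‖ψ c‖²)/2)`
  have hpt : ∀ c : Bond d m, c₁ * (A * ‖ψt c‖ ^ 2 - |B| * ((‖ψt (shift c.2 c.1, c.2)‖ ^ 2 + ‖ψt c‖ ^ 2) / 2)) ≤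
      RCLike.re (((c₁ : ℝ) : ℂ) * ⟪WL2.equiv ℂ (fun _ : Bond d m => c₁) W v c, ψt c⟫_ℂ) := by
    intro c
    have hself : (⟪ψt c, ψt c⟫_ℂ).re = ‖ψt c‖ ^ 2 := by
      rw [← RCLike.re_to_complex]; exact inner_self_eq_norm_sq (𝕜 := ℂ) _
    rw [hv c, inner_add_left, inner_smul_left, inner_smul_left, Complex.conj_ofReal, Complex.conj_ofReal]
    simp only [RCLike.re_to_complex, Complex.re_ofReal_mul, Complex.add_re]
    rw [hself]
    refine mul_le_mul_of_nonneg_left ?_ hc₁.le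
    have hcs : |(⟪ψt (shift c.2 c.1, c.2), ψt c⟫_ℂ).re| ≤ ‖ψt (shift c.2 c.1, c.2)‖ * ‖ψt c‖ := by
      have h := (RCLike.abs_re_le_norm (⟪ψt (shift c.2 c.1, c.2), ψt c⟫_ℂ)).trans (norm_inner_le_norm _ _)
      rwa [RCLike.re_to_complex] at h
    have hB : -(|B| * (‖ψt (shift c.2 c.1, c.2)‖ * ‖ψt c‖)) ≤ B * (⟪ψt (shift c.2 c.1, c.2), ψt c⟫_ℂ).re := by
      have h1 : |B * (⟪ψt (shift c.2 c.1, c.2), ψt c⟫_ℂ).re| ≤ |B| * (‖ψt (shift c.2 c.1, c.2)‖ * ‖ψt c‖) := by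
        rw [abs_mul]; exact mul_le_mul_of_nonneg_left hcs (abs_nonneg B)
      linarith [neg_abs_le (B * (⟪ψt (shift c.2 c.1, c.2), ψt c⟫_ℂ).re)]
    nlinarith [sq_nonneg (‖ψt (shift c.2 c.1, c.2)‖ - ‖ψt c‖), abs_nonneg B]
  have hsum := Finset.sum_le_sum fun c (_ : c ∈ Finset.univ) => hpt c
  rw [← map_sum] at hsum
  -- evaluate the left sum: the shifted squares sum to the same total
  have hshift : ∑ c : Bond d m, c₁ * ‖ψt (shift c.2 c.1, c.2)‖ ^ 2 = ∑ c : Bond d m, c₁ * ‖ψt c‖ ^ 2 :=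
    sum_shift_bond_eq m (fun c => c₁ * ‖ψt c‖ ^ 2)
  have e2 : ∑ c : Bond d m, c₁ * (A * ‖ψt c‖ ^ 2 - |B| * ((‖ψt (shift c.2 c.1, c.2)‖ ^ 2 + ‖ψt c‖ ^ 2) / 2)) =
      (A - |B| / 2) * ∑ c : Bond d m, c₁ * ‖ψt c‖ ^ 2 - |B| / 2 * ∑ c : Bond d m, c₁ * ‖ψt (shift c.2 c.1, c.2)‖ ^ 2 := by
    rw [Finset.mul_sum, Finset.mul_sum, ← Finset.sum_sub_distrib]
    exact Finset.sum_congr rfl fun c _ => by ring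
  rw [e2, hshift] at hsum
  rw [WL2.inner_def, WL2.norm_sq]
  refine le_trans (le_of_eq ?_) hsum
  ring

/-- **THE SIZE OF A TWO-BLOCK FORM**: `‖v‖² ≤ 2(A² + B²)·‖ψ‖²`. [folklore] [cite: Balaban1985BackgroundPropagators, (3.15)–(3.16) p.393] -/
theorem norm_sq_le_of_twoBlock (v ψ : BondL2K ℂ d m c₁ W) {A B : ℝ}
    (hv : ∀ c : Bond d m, WL2.equiv ℂ (fun _ : Bond d m => c₁) W v c =
      ((A : ℝ) : ℂ) • WL2.equiv ℂ (fun _ : Bond d m => c₁) W ψ c + ((B : ℝ) : ℂ) • WL2.equiv ℂ (fun _ : Bond d m => c₁) W ψ (shift c.2 c.1, c.2)) :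
    ‖v‖ ^ 2 ≤ 2 * (A ^ 2 + B ^ 2) * ‖ψ‖ ^ 2 := by
  have hc₁ : 0 < c₁ := Fact.out
  set ψt := WL2.equiv ℂ (fun _ : Bond d m => c₁) W ψ with hψt
  rw [WL2.norm_sq, WL2.norm_sq]
  have hpt : ∀ c : Bond d m, c₁ * ‖WL2.equiv ℂ (fun _ : Bond d m => c₁) W v c‖ ^ 2 ≤
      c₁ * (2 * (A ^ 2 * ‖ψt c‖ ^ 2 + B ^ 2 * ‖ψt (shift c.2 c.1, c.2)‖ ^ 2)) := by
    intro c
    refine mul_le_mul_of_nonneg_left ?_ hc₁.le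
    have h1 : ‖WL2.equiv ℂ (fun _ : Bond d m => c₁) W v c‖ ≤ |A| * ‖ψt c‖ + |B| * ‖ψt (shift c.2 c.1, c.2)‖ := by
      rw [hv c]
      refine (norm_add_le _ _).trans (le_of_eq ?_)
      rw [norm_smul, norm_smul, Complex.norm_real, Complex.norm_real, Real.norm_eq_abs, Real.norm_eq_abs]
    refine (pow_le_pow_left₀ (norm_nonneg _) h1 2).trans ?_
    nlinarith [sq_nonneg (|A| * ‖ψt c‖ - |B| * ‖ψt (shift c.2 c.1, c.2)‖), sq_abs A, sq_abs B]
  refine (Finset.sum_le_sum fun c _ => hpt c).trans (le_of_eq ?_)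
  have hshift : ∑ c : Bond d m, c₁ * ‖ψt (shift c.2 c.1, c.2)‖ ^ 2 = ∑ c : Bond d m, c₁ * ‖ψt c‖ ^ 2 :=
    sum_shift_bond_eq m (fun c => c₁ * ‖ψt c‖ ^ 2)
  have e2 : ∑ c : Bond d m, c₁ * (2 * (A ^ 2 * ‖ψt c‖ ^ 2 + B ^ 2 * ‖ψt (shift c.2 c.1, c.2)‖ ^ 2)) =
      2 * A ^ 2 * ∑ c : Bond d m, c₁ * ‖ψt c‖ ^ 2 + 2 * B ^ 2 * ∑ c : Bond d m, c₁ * ‖ψt (shift c.2 c.1, c.2)‖ ^ 2 := by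
    rw [Finset.mul_sum, Finset.mul_sum, ← Finset.sum_add_distrib]
    exact Finset.sum_congr rfl fun c _ => by ring
  rw [e2, hshift]
  ring

end TwoBlock

/-! ## §4 `Q(1)` of the two-profile lift `u(x,κ) = f₁(off_κ x)·Π_{ν≠κ} f₀(off_ν x)·ψ(blk x, κ)` is a two-block form -/

section Lift

variable {d : ℕ} (L : ℕ) [NeZero L] (m : Fin d → ℕ) [∀ i, NeZero (fineP L m i)]
  {𝔸 : Type*} [NormedRing 𝔸] [NormOneClass 𝔸] [NormedAlgebra ℂ 𝔸] [CompleteSpace 𝔸] (hL : 1 ≤ L)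
  {α' : ℝ} (hα1' : α' ≤ 1 / 64)
  (hU1' : ∀ (x : B7Prop1Explicit.Site d) (κ : Fin d), perCfg (fineP L m) (fun _ : Bond d (fineP L m) => (1 : 𝔸ˣ)) x κ ∈ U1 𝔸)
  (hreg' : ∀ (y : TSite d m) (κ : Fin d) (r : Fin d → Fin L),
    ‖((Wcx L (perCfg (fineP L m) (fun _ : Bond d (fineP L m) => (1 : 𝔸ˣ))) (cornerSite L y) κ (boxVec L r) : 𝔸ˣ) : 𝔸) - 1‖ ≤ α')
  {W : Type*} [NormedAddCommGroup W] [InnerProductSpace ℂ W] (φ : W ≃ₗ[ℂ] 𝔸) (c₀ : ℝ) (c₁ : ℝ)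

omit [NeZero L] [∀ i, NeZero (fineP L m i)] in
/-- the two-profile coefficient as a product over all coordinates of the family `F^κ_ν = f₁ (ν = κ), f₀ (ν ≠ κ)`. [folklore]
[cite: Balaban1984PropagatorsII, (2.74)–(2.77) p.236] -/
theorem twoProfile_eq_prod (f₀ f₁ : ℕ → ℝ) (κ : Fin d) (o : Fin d → ℕ) :
    f₁ (o κ) * ∏ ν ∈ Finset.univ.erase κ, f₀ (o ν) = ∏ ν, (fun κ' ν => if ν = κ' then f₁ else f₀) κ ν (o ν) := by
  rw [← Finset.mul_prod_erase Finset.univ _ (Finset.mem_univ κ)]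
  dsimp only
  rw [if_pos rfl]
  congr 1
  exact Finset.prod_congr rfl fun ν hν => by rw [if_neg (Finset.ne_of_mem_erase hν)]

omit [NeZero L] [∀ i, NeZero (fineP L m i)] in
/-- the transverse factor of the two-profile family: `Π_{ν≠κ} Σ_k F^κ_ν(k) = (Σ_k f₀(k))^{d−1}`. [folklore]
[cite: Balaban1984PropagatorsII, (2.74)–(2.77) p.236] -/
theorem prod_erase_sum_twoProfile (f₀ f₁ : ℕ → ℝ) (κ : Fin d) :
    ∏ ν ∈ Finset.univ.erase κ, ∑ k ∈ Finset.range L, (fun κ' ν => if ν = κ' then f₁ else f₀) κ ν k = (∑ k ∈ Finset.range L, f₀ k) ^ (d - 1) := by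
  have h : ∀ ν ∈ Finset.univ.erase κ, ∑ k ∈ Finset.range L, (fun κ' ν => if ν = κ' then f₁ else f₀) κ ν k = ∑ k ∈ Finset.range L, f₀ k := by
    intro ν hν
    dsimp only
    rw [if_neg (Finset.ne_of_mem_erase hν)]
  rw [Finset.prod_congr rfl h, Finset.prod_const, Finset.card_erase_of_mem (Finset.mem_univ κ), Finset.card_univ, Fintype.card_fin]

/-- **`Q(1)` OF THE TWO-PROFILE LIFT IS A TWO-BLOCK FORM** with the SAME two numbers at every coarse bond:
`(Q(1)u)(y,κ) = A·ψ(y,κ) + B·ψ(y+e_κ,κ)`, `A = L^{−(d+1)}(Σf₀)^{d−1}·Σ_kΣ_{i<L−k}f₁(k+i)`, `B = L^{−(d+1)}(Σf₀)^{d−1}·Σ_kΣ_{t<k}f₁(t)` — [B7] (125) at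
`V₀ = 1` (`B9Eq315QFlatNorm.QtorusLin_one_apply`) on the lift, with the sweep counts of §2. [folklore]
[cite: Balaban1985Averaging, (125) p.36; Balaban1985BackgroundPropagators, (3.15) p.393] -/
theorem QtorusW_one_twoProfileLift_apply (f₀ f₁ : ℕ → ℝ) (ψ : BondL2K ℂ d m c₁ W) (c : Bond d m) :
    WL2.equiv ℂ (fun _ : Bond d m => c₁) W
      (QtorusW L m hL φ (fun _ : Bond d (fineP L m) => (1 : 𝔸ˣ)) hα1' hU1' hreg' (c₀ := c₀) (c₁ := c₁)
        ((WL2.equiv ℂ (fun _ : Bond d (fineP L m) => c₀) W).symm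
          (fun b => ((f₁ (offset L m b.1 b.2) * ∏ ν ∈ Finset.univ.erase b.2, f₀ (offset L m b.1 ν) : ℝ) : ℂ) •
            WL2.equiv ℂ (fun _ : Bond d m => c₁) W ψ (blockCoord L m b.1, b.2)))) c =
      (((((L : ℝ) ^ (d + 1))⁻¹ * ((∑ k ∈ Finset.range L, f₀ k) ^ (d - 1) * ∑ k ∈ Finset.range L, ∑ i ∈ Finset.range (L - k), f₁ (k + i)) : ℝ) : ℂ)) •
          WL2.equiv ℂ (fun _ : Bond d m => c₁) W ψ c +
      (((((L : ℝ) ^ (d + 1))⁻¹ * ((∑ k ∈ Finset.range L, f₀ k) ^ (d - 1) * ∑ k ∈ Finset.range L, ∑ t ∈ Finset.range k, f₁ t) : ℝ) : ℂ)) •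
          WL2.equiv ℂ (fun _ : Bond d m => c₁) W ψ (shift c.2 c.1, c.2) := by
  obtain ⟨y, κ⟩ := c
  set ψt := WL2.equiv ℂ (fun _ : Bond d m => c₁) W ψ with hψt
  set F : Fin d → Fin d → ℕ → ℝ := fun κ' ν => if ν = κ' then f₁ else f₀ with hF
  rw [QtorusW_apply, QtorusLin_one_apply L m hL hα1' hU1' hreg']
  -- the summands are `φ` of the lift's values; pull `φ` and the real factor out
  have hsum : ∑ r : Fin d → Fin L, ∑ i ∈ Finset.range L,
      φ (WL2.equiv ℂ (fun _ : Bond d (fineP L m) => c₀) W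
        ((WL2.equiv ℂ (fun _ : Bond d (fineP L m) => c₀) W).symm
          (fun b => ((f₁ (offset L m b.1 b.2) * ∏ ν ∈ Finset.univ.erase b.2, f₀ (offset L m b.1 ν) : ℝ) : ℂ) • ψt (blockCoord L m b.1, b.2)))
        (perSite (fineP L m) (cornerSite L y + boxVec L r + (i : ℤ) • e κ), κ)) =
      φ (∑ r : Fin d → Fin L, ∑ i ∈ Finset.range L,
        ((∏ ν, F κ ν (offset L m (perSite (fineP L m) (cornerSite L y + boxVec L r + (i : ℤ) • e κ)) ν) : ℝ) : ℂ) •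
          ψt (blockCoord L m (perSite (fineP L m) (cornerSite L y + boxVec L r + (i : ℤ) • e κ)), κ)) := by
    rw [map_sum]
    refine Finset.sum_congr rfl fun r _ => ?_
    rw [map_sum]
    refine Finset.sum_congr rfl fun i _ => ?_
    rw [Equiv.apply_symm_apply, twoProfile_eq_prod]
  rw [hsum, sum_sweep_prodLift L m F ψt y κ, prod_erase_sum_twoProfile L f₀ f₁ κ, RCLike.real_smul_eq_coe_smul (K := ℂ), ← map_smul,
    LinearEquiv.symm_apply_apply, smul_add, smul_smul, smul_smul]
  have hF1 : F κ κ = f₁ := by rw [hF]; dsimp only; rw [if_pos rfl]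
  simp only [hF1]
  push_cast
  ring_nf

end Lift

end Literature.MathematicalPhysics.QuantumFieldTheory.Balaban1983to89.B9Eq3126BondTentLift

end
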